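import Literature.Geometry.GeometricMeasureTheory.CurrentsDilation
import Literature.Geometry.GeometricMeasureTheory.EulerCartan
import Mathlib.MeasureTheory.Integral.Prod
import HarnessLib

/-!
# The Euler homotopy formula for cycles representable by integration

The analytic heart of flat-norm estimates between a current and its dilates `μ_{s#} T`
([Federer1969, 4.1.9]: the homotopy formula for `h(t, x) = t x`), for currents representable by
integration `T = μ ∧ η` (`vectorCurrent` of `Currents.lean`) on the unit ball `B`, built on the
pointwise Cartan formula and the ray identity of `EulerCartan.lean`:

* `exists_testForm_curryLeft_smul`, `exists_testForm_pow_smul_comp_smul` — for `spt ψ ⊆ B(0,s)` and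
  `0 < s ≤ t`, the forms `z ↦ ι_{tz} ψ(tz)` and `μ_s^*ψ = s^{k+1} ψ(s ·)` are test forms on `B`;
* `integral_apply_extDeriv_curryLeft_smul_eq_zero` — for a CYCLE `T = μ ∧ η` on `B` (`∂T = 0`) the
  exact part of the ray identity integrates to zero:
  `∫ ⟨d(ι_X ψ)(t y), η(y)⟩ dμ = t⁻¹ ∂T(χ_t) = 0`;
* `integral_apply_sub_pullback_eq` — **the homotopy formula for cycles**:
  `T(ψ) − T(μ_s^* ψ) = ∫ ⟨∫_s^1 t^{k+1} ι_y dψ(t y) dt, η(y)⟩ dμ(y)`, i.e.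
  `T − μ_{s#} T = ∂ h_#([s,1] × T)` tested on `ψ` with `spt ψ ⊆ B(0,s)`, the right-hand side being
  the explicit cone (join) integral [Federer1969, 4.1.9–4.1.11] (Fubini, and `∂T = 0` kills the
  exact part). Its estimate by the conical defect `∫ |y ∧ η⃗| d‖T‖` is what turns decay of the
  defect into flat convergence of blow-ups (tangent cones, [Federer1969, 4.3.16–4.3.18]).

No definitions, no named facts; the cone current itself (whose rectifiability needs the area
formula) is not constructed here — only its action on exact forms is computed.

## References

* H. Federer, *Geometric Measure Theory*, Springer 1969, 4.1.8–4.1.11 (homotopies, joins, cones)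
  [Federer1969].
-/

open Filter
open scoped Topology

namespace Literature.Geometry.GeometricMeasureTheory

open MeasureTheory TopologicalSpace Set Metric
open scoped Distributions Interval

/-! ### Test forms along the Euler homotopy on the unit ball -/

section Forms

-- Nested operator-norm instances on (duals of) `E [⋀^Fin m]→L[ℝ] ℝ`.
set_option maxSynthPendingDepth 2

variable {V : Type*} [NormedAddCommGroup V] [NormedSpace ℝ V] {F : Type*} [NormedAddCommGroup F]
  [NormedSpace ℝ F] {k : ℕ}

/-- The interior product with the position vector is smooth in `x` when `ψ` is. [folklore] -/
theorem ContDiff.curryLeft_self {n : WithTop ℕ∞} {ψ : V → V [⋀^Fin (k + 1)]→L[ℝ] F}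
    (hψ : ContDiff ℝ n ψ) : ContDiff ℝ n (fun y => (ψ y).curryLeft y) :=
  (isBoundedBilinearMap_curryLeft (V := V) (F := F) (k := k)).contDiff.comp (hψ.prodMk contDiff_id)

/-- The support of `x ↦ ι_x ψ(x)` lies in the support of `ψ`. [folklore] -/
theorem support_curryLeft_self_subset (ψ : V → V [⋀^Fin (k + 1)]→L[ℝ] F) :
    Function.support (fun y => (ψ y).curryLeft y) ⊆ Function.support ψ := by
  intro y hy
  rw [Function.mem_support] at hy ⊢
  intro h
  exact hy (by rw [h, ContinuousAlternatingMap.curryLeft_zero, zero_apply])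

variable {B : Opens V}

/-- **The dilated interior product `z ↦ ι_{tz} ψ(tz)` is a test form on the ball** when
`spt ψ ⊆ B(0,s)` and `0 < s ≤ t`: it is smooth with compact support `t⁻¹ spt ψ ⊆ B(0, s/t) ⊆ B(0,1)`.
(For `B` the unit ball.) [cite: Federer1969, 4.1.9] -/
theorem exists_testForm_curryLeft_smul (hB : (B : Set V) = Metric.ball (0 : V) 1)
    (ψ : 𝓓(B, V [⋀^Fin (k + 1)]→L[ℝ] F)) {s t : ℝ} (hs : 0 < s) (hst : s ≤ t)
    (hψs : tsupport ⇑ψ ⊆ Metric.ball (0 : V) s) :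
    ∃ χ : 𝓓(B, V [⋀^Fin k]→L[ℝ] F), ∀ z, χ z = (ψ (t • z)).curryLeft (t • z) := by
  have ht : 0 < t := hs.trans_le hst
  let e : V ≃ₜ V := Homeomorph.smulOfNeZero t ht.ne'
  have he : ∀ z, e z = t • z := fun z => rfl
  let ι : V → V [⋀^Fin k]→L[ℝ] F := fun x => (ψ x).curryLeft x
  have hιs : HasCompactSupport ι := ψ.hasCompactSupport.mono (support_curryLeft_self_subset ⇑ψ)
  have hfun : (fun z => (ψ (t • z)).curryLeft (t • z)) = ι ∘ e := rfl
  refine ⟨⟨fun z => (ψ (t • z)).curryLeft (t • z), ?_, ?_, ?_⟩, fun z => rfl⟩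
  · exact (ContDiff.curryLeft_self ψ.contDiff).comp (contDiff_id.const_smul t)
  · rw [hfun]
    exact hιs.comp_homeomorph e
  · rw [hfun, tsupport, Function.support_comp_eq_preimage, ← e.preimage_closure, hB]
    intro z hz
    have h1 : e z ∈ tsupport ⇑ψ := closure_mono (support_curryLeft_self_subset ⇑ψ) hz
    have h2 : ‖t • z‖ < s := mem_ball_zero_iff.1 (hψs h1)
    rw [norm_smul, Real.norm_of_nonneg ht.le] at h2
    rw [mem_ball_zero_iff]
    by_contra hcon
    push Not at hcon
    have : s ≤ t * ‖z‖ := by nlinarith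
    linarith

/-- **The pulled-back form `μ_s^* ψ = s^{k+1} ψ(s ·)` is a test form on the ball** when
`spt ψ ⊆ B(0,s)`, `0 < s`: support `s⁻¹ spt ψ ⊆ B(0,1)`. (For `B` the unit ball.)
[cite: Federer1969, 4.1.9] -/
theorem exists_testForm_pow_smul_comp_smul (hB : (B : Set V) = Metric.ball (0 : V) 1)
    (ψ : 𝓓(B, V [⋀^Fin (k + 1)]→L[ℝ] F)) {s : ℝ} (hs : 0 < s)
    (hψs : tsupport ⇑ψ ⊆ Metric.ball (0 : V) s) :
    ∃ χ : 𝓓(B, V [⋀^Fin (k + 1)]→L[ℝ] F), ∀ y, χ y = s ^ (k + 1) • ψ (s • y) := by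
  let e : V ≃ₜ V := Homeomorph.smulOfNeZero s hs.ne'
  have hsupp : Function.support (fun y => s ^ (k + 1) • ψ (s • y)) ⊆ Function.support (⇑ψ ∘ ⇑e) := by
    intro y hy
    rw [Function.mem_support] at hy ⊢
    intro h
    exact hy (by rw [show ψ (s • y) = (⇑ψ ∘ ⇑e) y from rfl, h, smul_zero])
  refine ⟨⟨fun y => s ^ (k + 1) • ψ (s • y), ?_, ?_, ?_⟩, fun y => rfl⟩
  · exact (ψ.contDiff.comp (contDiff_id.const_smul s)).const_smul (s ^ (k + 1))
  · exact (ψ.hasCompactSupport.comp_homeomorph e).mono hsupp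
  · rw [hB]
    refine (closure_mono hsupp).trans ?_
    rw [← tsupport, tsupport, Function.support_comp_eq_preimage, ← e.preimage_closure]
    intro y hy
    have h2 : ‖s • y‖ < s := mem_ball_zero_iff.1 (hψs hy)
    rw [norm_smul, Real.norm_of_nonneg hs.le] at h2
    rw [mem_ball_zero_iff]
    by_contra hcon
    push Not at hcon
    have : s ≤ s * ‖y‖ := by nlinarith
    linarith

end Forms

/-! ### The homotopy formula for cycles representable by integration -/

section Cone

-- Nested operator-norm instances on (duals of) `E [⋀^Fin m]→L[ℝ] ℝ`, as in `Currents.lean`.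
set_option maxSynthPendingDepth 2

variable {V : Type*} [NormedAddCommGroup V] [NormedSpace ℝ V] [MeasurableSpace V]
  [OpensMeasurableSpace V] [SecondCountableTopology V] {k : ℕ} {B : Opens V}

omit [MeasurableSpace V] [OpensMeasurableSpace V] [SecondCountableTopology V] in
/-- Pairing an a.e. strongly measurable multivector field with a continuous form is a.e. strongly
measurable. [folklore] -/
theorem aestronglyMeasurable_apply_of_continuous {X : Type*} [TopologicalSpace X]
    [MeasurableSpace X] [OpensMeasurableSpace X] [SecondCountableTopology X] {μ : Measure X}
    {m : ℕ} {η : X → Multivector V m} (hη : AEStronglyMeasurable η μ) {g : X → Covector V m}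
    (hg : Continuous g) : AEStronglyMeasurable (fun y => η y (g y)) μ :=
  (isBoundedBilinearMap_apply (𝕜 := ℝ) (E := Covector V m) (F := ℝ)).continuous.comp_aestronglyMeasurable
    (hη.prodMk hg.aestronglyMeasurable)

omit [MeasurableSpace V] [OpensMeasurableSpace V] [SecondCountableTopology V] in
/-- Pairing an integrable multivector field with a continuous form bounded (a.e.) by `C` is
integrable. [folklore] -/
theorem integrable_apply_of_norm_le {X : Type*} [TopologicalSpace X]
    [MeasurableSpace X] [OpensMeasurableSpace X] [SecondCountableTopology X] {μ : Measure X}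
    {m : ℕ} {η : X → Multivector V m} (hη : Integrable η μ) {g : X → Covector V m}
    (hg : Continuous g) {C : ℝ} (hC : ∀ᵐ y ∂μ, ‖g y‖ ≤ C) :
    Integrable (fun y => η y (g y)) μ := by
  refine Integrable.mono' (hη.norm.mul_const C) (aestronglyMeasurable_apply_of_continuous hη.1 hg)
    ?_
  filter_upwards [hC] with y hy
  calc ‖η y (g y)‖ ≤ ‖η y‖ * ‖g y‖ := (η y).le_opNorm _
    _ ≤ ‖η y‖ * C := by gcongr

omit [SecondCountableTopology V] in
/-- **For a cycle the exact part of the ray identity integrates to zero**: if `∂(μ ∧ η) = 0` on the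
unit ball `B`, `spt ψ ⊆ B(0,s)` and `0 < s ≤ t`, then `∫ ⟨d(ι_X ψ)(t y), η(y)⟩ dμ(y) = 0` — it is
`t⁻¹ (μ ∧ η)(dχ_t) = t⁻¹ ∂(μ ∧ η)(χ_t)` for the test form `χ_t(z) = ι_{tz} ψ(tz)`.
[cite: Federer1969, 4.1.9] -/
theorem integral_apply_extDeriv_curryLeft_smul_eq_zero (hB : (B : Set V) = Metric.ball (0 : V) 1)
    {μ : Measure V} {η : V → Multivector V (k + 1)} (hη : LocallyIntegrableOn η (B : Set V) μ)
    (hcycle : Current.boundary (vectorCurrent μ η : Current B (k + 1)) = 0)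
    (ψ : TestForm B (k + 1)) {s t : ℝ} (hs : 0 < s) (hst : s ≤ t)
    (hψs : tsupport ⇑ψ ⊆ Metric.ball (0 : V) s) :
    ∫ y, η y (extDeriv (fun x => (ψ x).curryLeft x) (t • y)) ∂μ = 0 := by
  have ht : 0 < t := hs.trans_le hst
  obtain ⟨χ, hχ⟩ := exists_testForm_curryLeft_smul hB ψ hs hst hψs
  have hιd : Differentiable ℝ (fun x => (ψ x).curryLeft x) :=
    (ContDiff.curryLeft_self ψ.contDiff).differentiable (by simp)
  have hd : ∀ z, extDeriv ⇑χ z = t • extDeriv (fun x => (ψ x).curryLeft x) (t • z) := by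
    intro z
    have e : (⇑χ : V → V [⋀^Fin k]→L[ℝ] ℝ) =
        fun z => (fun x => (ψ x).curryLeft x) ((0 : V) + t • z) := by
      funext z
      rw [hχ, zero_add]
    rw [e, extDeriv_comp_add_smul _ hιd 0 t z, zero_add]
  have hd' : ∀ y, extDeriv (fun x => (ψ x).curryLeft x) (t • y) = t⁻¹ • extDeriv ⇑χ y := by
    intro y
    rw [hd, smul_smul, inv_mul_cancel₀ ht.ne', one_smul]
  simp_rw [hd', map_smul, smul_eq_mul]
  rw [integral_const_mul]
  have h1 := congrArg (fun T : Current B k => T χ) hcycle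
  simp only [Current.boundary_apply] at h1
  rw [vectorCurrent_apply hη, TestForm.extDerivCLM_apply] at h1
  rw [show ∫ y, η y (extDeriv ⇑χ y) ∂μ = 0 from h1, mul_zero]

omit [MeasurableSpace V] [OpensMeasurableSpace V] [SecondCountableTopology V] in
/-- `dψ = 0` off the support of `ψ`. [folklore] -/
theorem extDeriv_eq_zero_of_notMem_tsupport' {F : Type*} [NormedAddCommGroup F] [NormedSpace ℝ F]
    {m : ℕ} (ψ : V → V [⋀^Fin m]→L[ℝ] F) {x : V} (hx : x ∉ tsupport ψ) : extDeriv ψ x = 0 := by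
  rw [extDeriv, fderiv_of_notMem_tsupport ℝ hx,
    ← ContinuousAlternatingMap.alternatizeUncurryFinCLM_apply, map_zero]

omit [MeasurableSpace V] [OpensMeasurableSpace V] [SecondCountableTopology V] in
/-- `d` of a smooth compactly supported form is continuous with compact support, hence bounded.
[folklore] -/
theorem exists_norm_extDeriv_le {F : Type*} [NormedAddCommGroup F] [NormedSpace ℝ F] {m : ℕ}
    {n : WithTop ℕ∞} (ψ : V → V [⋀^Fin m]→L[ℝ] F) (hψ : ContDiff ℝ n ψ) (hn : n ≠ 0)
    (hs : HasCompactSupport ψ) :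
    Continuous (extDeriv ψ) ∧ ∃ C, 0 ≤ C ∧ ∀ x, ‖extDeriv ψ x‖ ≤ C := by
  have e : extDeriv ψ = fun x =>
      ContinuousAlternatingMap.alternatizeUncurryFinCLM ℝ V F (fderiv ℝ ψ x) := by
    funext x
    rw [ContinuousAlternatingMap.alternatizeUncurryFinCLM_apply]
    rfl
  have hc : Continuous (extDeriv ψ) := by
    rw [e]
    exact (ContinuousAlternatingMap.alternatizeUncurryFinCLM ℝ V F).continuous.comp
      (hψ.continuous_fderiv hn)
  have hcs : HasCompactSupport (extDeriv ψ) := by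
    rw [e]
    exact (hs.fderiv (𝕜 := ℝ)).comp_left
      (g := ⇑(ContinuousAlternatingMap.alternatizeUncurryFinCLM ℝ V F)) (map_zero _)
  obtain ⟨C, hC⟩ := hc.bounded_above_of_compact_support hcs
  exact ⟨hc, max C 0, le_max_right _ _, fun x => (hC x).trans (le_max_left _ _)⟩

set_option maxHeartbeats 800000 in
/-- **The homotopy formula for cycles** (Federer's `T − μ_{s#}T = ∂ h_#([s,1] × T)` for the Euler
homotopy `h(t,x) = tx`, tested on forms supported in `B(0,s)`): if `T = μ ∧ η` is a cycle on the
unit ball `B` with `η` integrable, `0 < s ≤ 1` and `spt ψ ⊆ B(0,s)`, then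
`T(ψ) − T(μ_s^*ψ) = ∫ ⟨∫_s^1 t^{k+1} ι_y dψ(t y) dt, η(y)⟩ dμ(y)`
— the right-hand side being the cone (join) integral `h_#([s,1] × T)(dψ)`. Proof: integrate the
ray identity against `η dμ`; the exact part vanishes (`∂T = 0`) after Fubini.
[cite: Federer1969, 4.1.9] -/
theorem integral_apply_sub_pullback_eq (hB : (B : Set V) = Metric.ball (0 : V) 1)
    {μ : Measure V} [SFinite μ] {η : V → Multivector V (k + 1)} (hηi : Integrable η μ)
    (hcycle : Current.boundary (vectorCurrent μ η : Current B (k + 1)) = 0)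
    {s : ℝ} (hs0 : 0 < s) (hs1 : s ≤ 1) (ψ : TestForm B (k + 1))
    (hψs : tsupport ⇑ψ ⊆ Metric.ball (0 : V) s) :
    ∫ y, η y (ψ y) ∂μ - ∫ y, η y (s ^ (k + 1) • ψ (s • y)) ∂μ =
      ∫ y, η y (∫ t in s..1, t ^ (k + 1) • (extDeriv ⇑ψ (t • y)).curryLeft y) ∂μ := by
  -- the two integrands of the ray identity
  set ι : V → V [⋀^Fin k]→L[ℝ] ℝ := fun x => (ψ x).curryLeft x with hι
  set F1 : ℝ → V → Covector V (k + 1) := fun t y => t ^ k • extDeriv ι (t • y) with hF1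
  set F2 : ℝ → V → Covector V (k + 1) :=
    fun t y => t ^ (k + 1) • (extDeriv ⇑ψ (t • y)).curryLeft y with hF2
  have hψ1 : ContDiff ℝ 1 ⇑ψ := ψ.contDiff.of_le (by exact_mod_cast le_top)
  have hιC := ContDiff.curryLeft_self ψ.contDiff
  have hιs : HasCompactSupport ι := ψ.hasCompactSupport.mono (support_curryLeft_self_subset ⇑ψ)
  obtain ⟨hdι, C1, hC1₀, hC1⟩ := exists_norm_extDeriv_le ι hιC (by simp) hιs
  obtain ⟨hdψ, C2, hC2₀, hC2⟩ := exists_norm_extDeriv_le ⇑ψ ψ.contDiff (by simp) ψ.hasCompactSupport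
  -- joint continuity of `F1`, `F2`
  have hc1 : Continuous (fun p : ℝ × V => F1 p.1 p.2) :=
    (continuous_fst.pow k).smul (hdι.comp (continuous_fst.smul continuous_snd))
  have hc2 : Continuous (fun p : ℝ × V => F2 p.1 p.2) :=
    (continuous_fst.pow (k + 1)).smul
      ((isBoundedBilinearMap_curryLeft (V := V) (F := ℝ) (k := k + 1)).continuous.comp
        ((hdψ.comp (continuous_fst.smul continuous_snd)).prodMk continuous_snd))
  -- pointwise bounds on `Ι s 1 ⊆ (0, 1]`
  have hIoc : ∀ t ∈ Ι s 1, 0 < t ∧ t ≤ 1 := fun t ht => by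
    rw [Set.uIoc_of_le hs1] at ht
    exact ⟨hs0.trans ht.1, ht.2⟩
  have hb1 : ∀ t ∈ Ι s 1, ∀ y, ‖F1 t y‖ ≤ C1 := by
    intro t ht y
    obtain ⟨ht0, ht1⟩ := hIoc t ht
    rw [hF1]
    dsimp only
    rw [norm_smul, norm_pow, Real.norm_of_nonneg ht0.le]
    calc t ^ k * ‖extDeriv ι (t • y)‖ ≤ 1 * C1 :=
          mul_le_mul (pow_le_one₀ ht0.le ht1) (hC1 _) (norm_nonneg _) zero_le_one
      _ = C1 := one_mul _
  have hb2 : ∀ t ∈ Ι s 1, ∀ y, ‖F2 t y‖ ≤ C2 := by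
    intro t ht y
    obtain ⟨ht0, ht1⟩ := hIoc t ht
    rw [hF2]
    dsimp only
    by_cases hy : ‖y‖ ≤ 1
    · rw [norm_smul, norm_pow, Real.norm_of_nonneg ht0.le]
      calc t ^ (k + 1) * ‖(extDeriv ⇑ψ (t • y)).curryLeft y‖
          ≤ 1 * (‖extDeriv ⇑ψ (t • y)‖ * ‖y‖) := by
            refine mul_le_mul (pow_le_one₀ ht0.le ht1) ?_ (norm_nonneg _) zero_le_one
            simpa [ContinuousAlternatingMap.norm_curryLeft] using
              ((extDeriv ⇑ψ (t • y)).curryLeft).le_opNorm y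
        _ ≤ 1 * (C2 * 1) := by gcongr; exact hC2 _
        _ = C2 := by ring
    · have hty : t • y ∉ tsupport ⇑ψ := by
        intro h
        have h1 : ‖t • y‖ < s := mem_ball_zero_iff.1 (hψs h)
        rw [norm_smul, Real.norm_of_nonneg ht0.le] at h1
        push Not at hy
        rw [Set.uIoc_of_le hs1] at ht
        nlinarith [ht.1]
      rw [extDeriv_eq_zero_of_notMem_tsupport' ⇑ψ hty, ContinuousAlternatingMap.curryLeft_zero,
        zero_apply, smul_zero, norm_zero]
      exact hC2₀
  -- the ray identity, pointwise
  have hray : ∀ y, ψ y - s ^ (k + 1) • ψ (s • y) = ∫ t in s..1, (F1 t y + F2 t y) := fun y =>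
    sub_pow_smul_apply_smul_eq_integral ⇑ψ hψ1 y s
  have hii1 : ∀ y, IntervalIntegrable (fun t => F1 t y) volume s 1 := fun y =>
    (hc1.comp (continuous_id.prodMk continuous_const)).intervalIntegrable s 1
  have hii2 : ∀ y, IntervalIntegrable (fun t => F2 t y) volume s 1 := fun y =>
    (hc2.comp (continuous_id.prodMk continuous_const)).intervalIntegrable s 1
  -- Step A: one integral
  obtain ⟨Cψ, hCψ⟩ := ψ.continuous.bounded_above_of_compact_support ψ.hasCompactSupport
  have hIψ : Integrable (fun y => η y (ψ y)) μ :=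
    integrable_apply_of_norm_le hηi ψ.continuous (Eventually.of_forall hCψ)
  have hIψs : Integrable (fun y => η y (s ^ (k + 1) • ψ (s • y))) μ := by
    refine integrable_apply_of_norm_le hηi (C := Cψ)
      ((ψ.continuous.comp (continuous_const_smul s)).const_smul (s ^ (k + 1)))
      (Eventually.of_forall fun y => ?_)
    rw [norm_smul, norm_pow, Real.norm_of_nonneg hs0.le]
    calc s ^ (k + 1) * ‖ψ (s • y)‖ ≤ 1 * Cψ :=
          mul_le_mul (pow_le_one₀ hs0.le hs1) (hCψ _) (norm_nonneg _) zero_le_one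
      _ = Cψ := one_mul _
  rw [← integral_sub hIψ hIψs]
  have hsub : ∀ y, η y (ψ y) - η y (s ^ (k + 1) • ψ (s • y)) =
      η y (∫ t in s..1, F1 t y) + η y (∫ t in s..1, F2 t y) := by
    intro y
    rw [← (η y).map_sub, hray y, intervalIntegral.integral_add (hii1 y) (hii2 y), (η y).map_add]
  simp_rw [hsub]
  -- Step B: split; both pieces are integrable (continuous and bounded inner integrals)
  have hI1 : Integrable (fun y => η y (∫ t in s..1, F1 t y)) μ := by
    refine integrable_apply_of_norm_le hηi (C := C1 * |1 - s|)
      (intervalIntegral.continuous_parametric_intervalIntegral_of_continuous'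
        (show Continuous (Function.uncurry fun y t => F1 t y) from
          hc1.comp (continuous_snd.prodMk continuous_fst)) s 1)
      (Eventually.of_forall fun y => ?_)
    exact intervalIntegral.norm_integral_le_of_norm_le_const fun t ht => hb1 t ht y
  have hI2 : Integrable (fun y => η y (∫ t in s..1, F2 t y)) μ := by
    refine integrable_apply_of_norm_le hηi (C := C2 * |1 - s|)
      (intervalIntegral.continuous_parametric_intervalIntegral_of_continuous'
        (show Continuous (Function.uncurry fun y t => F2 t y) from
          hc2.comp (continuous_snd.prodMk continuous_fst)) s 1)
      (Eventually.of_forall fun y => ?_)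
    exact intervalIntegral.norm_integral_le_of_norm_le_const fun t ht => hb2 t ht y
  rw [integral_add hI1 hI2]
  suffices h0 : ∫ y, η y (∫ t in s..1, F1 t y) ∂μ = 0 by rw [h0, zero_add]
  -- Step C: the exact part — CLM through the `t`-integral, Fubini, and `∂T = 0`
  have hcomm : ∀ y, η y (∫ t in s..1, F1 t y) = ∫ t in s..1, η y (F1 t y) := fun y =>
    ((η y).intervalIntegral_comp_comm (hii1 y)).symm
  simp_rw [hcomm]
  have hint : Integrable (Function.uncurry fun t y => η y (F1 t y))
      ((volume.restrict (Ι s 1)).prod μ) := by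
    have hvol : Integrable (fun _ : ℝ => C1) (volume.restrict (Ι s 1)) := by
      refine integrable_const_iff.2 (Or.inr ⟨?_⟩)
      rw [Measure.restrict_apply_univ, Real.volume_uIoc]
      exact ENNReal.ofReal_lt_top
    refine Integrable.mono' (hvol.mul_prod hηi.norm) ?_ ?_
    · exact aestronglyMeasurable_apply_of_continuous hηi.1.comp_snd hc1
    · have hae : ∀ᵐ z ∂((volume.restrict (Ι s 1)).prod μ), z.1 ∈ Ι s 1 := by
        rw [ae_iff]
        have hset : {z : ℝ × V | ¬z.1 ∈ Ι s 1} = (Ι s 1)ᶜ ×ˢ (univ : Set V) := by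
          ext z
          simp
        rw [hset, Measure.prod_prod, Measure.restrict_apply measurableSet_uIoc.compl,
          compl_inter_self, measure_empty, zero_mul]
      filter_upwards [hae] with z hz
      show ‖η z.2 (F1 z.1 z.2)‖ ≤ C1 * ‖η z.2‖
      calc ‖η z.2 (F1 z.1 z.2)‖ ≤ ‖η z.2‖ * ‖F1 z.1 z.2‖ := (η z.2).le_opNorm _
        _ ≤ ‖η z.2‖ * C1 := by gcongr; exact hb1 _ hz _
        _ = C1 * ‖η z.2‖ := mul_comm _ _
  rw [← MeasureTheory.intervalIntegral_integral_swap hint]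
  have hinner : ∀ t ∈ Set.uIcc s 1, ∫ y, η y (F1 t y) ∂μ = 0 := by
    intro t ht
    rw [Set.uIcc_of_le hs1] at ht
    have e : ∀ y, η y (F1 t y) = t ^ k * η y (extDeriv ι (t • y)) := fun y => by
      rw [hF1]
      dsimp only
      rw [(η y).map_smul, smul_eq_mul]
    simp_rw [e]
    rw [integral_const_mul, integral_apply_extDeriv_curryLeft_smul_eq_zero hB
      (hηi.locallyIntegrable.locallyIntegrableOn _) hcycle ψ hs0 ht.1 hψs, mul_zero]
  rw [intervalIntegral.integral_congr hinner, intervalIntegral.integral_zero]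

end Cone

/-! ### The conical defect bound -/

section Defect

-- Nested operator-norm instances on (duals of) `E [⋀^Fin m]→L[ℝ] ℝ`, as in `Currents.lean`.
set_option maxSynthPendingDepth 2

variable {V : Type*} [NormedAddCommGroup V] [InnerProductSpace ℝ V] {m : ℕ}

/-- **The comass–defect inequality**: for an orthonormal `m`-frame `ξ`, an `(m+1)`-covector `φ`,
a vector `y` and ANY `z` in the span of `ξ`: `|φ(y, ξ₁, …, ξₘ)| ≤ ‖φ‖ · ‖y − z‖` — the frame
absorbs the component of `y` along the plane (alternation), so only the conical defect
`dist(y, span ξ)` of the position vector enters (`|y ∧ ξ| = |y^⊥|`). [cite: Federer1969, 1.8.1] -/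
theorem abs_apply_vecCons_le_mul_norm_sub (φ : V [⋀^Fin (m + 1)]→L[ℝ] ℝ) {ξ : Fin m → V}
    (hξ : Orthonormal ℝ ξ) (y : V) {z : V} (hz : z ∈ Submodule.span ℝ (Set.range ξ)) :
    |φ (Matrix.vecCons y ξ)| ≤ ‖φ‖ * ‖y - z‖ := by
  have hdep : ¬LinearIndependent ℝ (Matrix.vecCons z ξ : Fin (m + 1) → V) := fun h =>
    ((linearIndependent_finCons (K := ℝ)).1 h).2 hz
  have h0 : φ (Matrix.vecCons z ξ) = 0 := φ.toAlternatingMap.map_linearDependent _ hdep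
  have hsplit : φ (Matrix.vecCons y ξ) = φ (Matrix.vecCons (y - z) ξ) := by
    conv_lhs => rw [← sub_add_cancel y z]
    rw [φ.vecCons_add, h0, add_zero]
  rw [hsplit]
  calc |φ (Matrix.vecCons (y - z) ξ)| = ‖φ (Matrix.vecCons (y - z) ξ)‖ := (Real.norm_eq_abs _).symm
    _ ≤ ‖φ‖ * ∏ i, ‖Matrix.vecCons (y - z) ξ i‖ := φ.le_opNorm _
    _ = ‖φ‖ * ‖y - z‖ := by
      rw [Fin.prod_univ_succ]
      simp [hξ.1]

/-- The conical-defect form of the cone integrand for rectifiable-type data: with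
`η(y) = θ(y) ξ₁(y) ∧ ⋯ ∧ ξₘ(y)`, `ξ(y)` orthonormal, and any `z ∈ span ξ(y)`,
`|⟨ι_y φ, η(y)⟩| = |θ(y)| |φ(y, ξ(y))| ≤ |θ(y)| ‖φ‖ ‖y − z‖`. [cite: Federer1969, 4.1.9] -/
theorem abs_frameVector_curryLeft_le {θ : ℤ} {ξ : Fin m → V} (hξ : Orthonormal ℝ ξ)
    (φ : V [⋀^Fin (m + 1)]→L[ℝ] ℝ) (y : V) {z : V} (hz : z ∈ Submodule.span ℝ (Set.range ξ)) :
    |((θ : ℝ) • frameVector ξ) (φ.curryLeft y)| ≤ |(θ : ℝ)| * (‖φ‖ * ‖y - z‖) := by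
  rw [FunLike.coe_smul, Pi.smul_apply, frameVector_apply,
    ContinuousAlternatingMap.curryLeft_apply_apply, smul_eq_mul, abs_mul]
  exact mul_le_mul_of_nonneg_left (abs_apply_vecCons_le_mul_norm_sub φ hξ y hz) (abs_nonneg _)

variable [MeasurableSpace V]

/-- **The conical-defect estimate of the cone integral** (the mass of `h_#([s,1] × T)` against the
comass): for data `η = θ ξ₁ ∧ ⋯ ∧ ξₘ` with `ξ(y)` orthonormal `μ`-a.e. and a measurable choice
`z(y) ∈ span ξ(y)` (e.g. the orthogonal projection of `y`), a form `φ` with `‖φ(x)‖ ≤ M` and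
`0 < s ≤ 1`:
`|∫ ⟨∫_s^1 tᵉ ι_y φ(t y) dt, η(y)⟩ dμ| ≤ (1 − s) · M · ∫ |θ(y)| ‖y − z(y)‖ dμ(y)` (any `e`) — decay of the
conical defect `∫ |θ| |y^⊥| d𝓗^m` controls the flat distance between `T` and `μ_{s#}T`.
[cite: Federer1969, 4.1.9] -/
theorem abs_integral_cone_le {μ : Measure V} {θ : V → ℤ} {ξ : V → Fin m → V} {z : V → V}
    (hξ : ∀ᵐ y ∂μ, Orthonormal ℝ (ξ y) ∧ z y ∈ Submodule.span ℝ (Set.range (ξ y)))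
    (hθz : Integrable (fun y => |(θ y : ℝ)| * ‖y - z y‖) μ)
    (φ : V → V [⋀^Fin (m + 1)]→L[ℝ] ℝ) {M : ℝ} (hM : ∀ x, ‖φ x‖ ≤ M)
    {s : ℝ} (hs0 : 0 < s) (hs1 : s ≤ 1) (e : ℕ)
    (hint : ∀ y, IntervalIntegrable (fun t : ℝ => t ^ e • (φ (t • y)).curryLeft y) volume s 1) :
    |∫ y, ((θ y : ℝ) • frameVector (ξ y))
        (∫ t in s..1, t ^ e • (φ (t • y)).curryLeft y) ∂μ| ≤
      (1 - s) * M * ∫ y, |(θ y : ℝ)| * ‖y - z y‖ ∂μ := by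
  -- pointwise bound, a.e.
  have hpt : ∀ᵐ y ∂μ, |((θ y : ℝ) • frameVector (ξ y))
      (∫ t in s..1, t ^ e • (φ (t • y)).curryLeft y)| ≤
      (1 - s) * M * (|(θ y : ℝ)| * ‖y - z y‖) := by
    filter_upwards [hξ] with y hy
    obtain ⟨hon, hzy⟩ := hy
    rw [← ((θ y : ℝ) • frameVector (ξ y)).intervalIntegral_comp_comm (hint y)]
    have hb : ∀ t ∈ Ι s 1, |((θ y : ℝ) • frameVector (ξ y)) (t ^ e • (φ (t • y)).curryLeft y)|
        ≤ M * (|(θ y : ℝ)| * ‖y - z y‖) := by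
      intro t ht
      rw [Set.uIoc_of_le hs1] at ht
      have ht0 : 0 < t := hs0.trans ht.1
      rw [map_smul, smul_eq_mul, abs_mul, abs_of_nonneg (pow_nonneg ht0.le _)]
      calc t ^ e * |((θ y : ℝ) • frameVector (ξ y)) ((φ (t • y)).curryLeft y)|
          ≤ 1 * (|(θ y : ℝ)| * (‖φ (t • y)‖ * ‖y - z y‖)) :=
            mul_le_mul (pow_le_one₀ ht0.le ht.2) (abs_frameVector_curryLeft_le hon _ y hzy)
              (abs_nonneg _) zero_le_one
        _ ≤ 1 * (|(θ y : ℝ)| * (M * ‖y - z y‖)) := by gcongr; exact hM _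
        _ = M * (|(θ y : ℝ)| * ‖y - z y‖) := by ring
    have h := intervalIntegral.norm_integral_le_of_norm_le_const (f := fun t : ℝ =>
      ((θ y : ℝ) • frameVector (ξ y)) (t ^ e • (φ (t • y)).curryLeft y))
      (C := M * (|(θ y : ℝ)| * ‖y - z y‖)) fun t ht => by
        rw [Real.norm_eq_abs]; exact hb t ht
    rw [Real.norm_eq_abs, abs_of_nonneg (by linarith : (0 : ℝ) ≤ 1 - s)] at h
    calc _ ≤ M * (|(θ y : ℝ)| * ‖y - z y‖) * (1 - s) := h
      _ = (1 - s) * M * (|(θ y : ℝ)| * ‖y - z y‖) := by ring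
  calc |∫ y, ((θ y : ℝ) • frameVector (ξ y))
          (∫ t in s..1, t ^ e • (φ (t • y)).curryLeft y) ∂μ|
      ≤ ∫ y, |((θ y : ℝ) • frameVector (ξ y))
          (∫ t in s..1, t ^ e • (φ (t • y)).curryLeft y)| ∂μ := abs_integral_le_integral_abs
    _ ≤ ∫ y, (1 - s) * M * (|(θ y : ℝ)| * ‖y - z y‖) ∂μ :=
        integral_mono_of_nonneg (Eventually.of_forall fun _ => abs_nonneg _)
          (hθz.const_mul _) hpt
    _ = (1 - s) * M * ∫ y, |(θ y : ℝ)| * ‖y - z y‖ ∂μ := integral_const_mul _ _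

end Defect

end Literature.Geometry.GeometricMeasureTheory
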